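import Summits.ABC.IUTFork.BrobergSqrt7
import Literature.IUT.LogVolume.Corollary22PartIILemmas
import HarnessLib

/-!
# Broberg's `abc`-example over `ℚ(√7)` as a point of the `λ`-line: the orders of `j(λ)` at every odd finite place

DEFINITION + proof file of the abc-iut cell (D-0079 RESCUE sub-cell R-W, W1 ROW DECISIONS seat abc-iut-W-row-2, gen 3); classical algebraic
number theory only; TAKES NO SIDE on [IUTchIII] Cor. 3.12 or on any author. The datum of rows «pilotDataOfK:broberg-Q7:7 / :11» of
HOME/plan/rescue/R-W/OPEN-10.md (the last two OPEN rows of the R-W window table): N. Broberg's example `a + b = c` over `ℚ(√7)`,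
`a = (8−3√7)²(5−2√7)`, `c = (4−3√7)⁴`, read as the point `λ = a/c` of `ℙ¹ ∖ {0,1,∞}` over `F_tpd = ℚ(√7)` ([GenEll] §1; [IUTchIV] Cor. 2.2).
PROVED here, over the arithmetic of `BrobergSqrt7` (`√7`, the prime elements `ϖ₂ = 3+√7`, `ϖ₃ = 2+√7`, `ϖ₃' = √7−2`, `ϖ₄₇ = 3√7−4`, the unit
`ε = 8+3√7`, the places `𝔭₃, 𝔭₃', 𝔭₄₇`):
* `Broberg.lam`, `Broberg.point : NFPoint` (DEFINITIONS: `λ` and the point `(ℚ(√7), λ)`);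
* the factorisations `λ = −ε⁻³·ϖ₃/ϖ₄₇⁴` (`lam_eq`) and `1 − λ = ε²·ϖ₂³·ϖ₃'¹²/ϖ₄₇⁴` (`one_sub_lam_eq`) in `ℤ[√7]`;
* the valuations `log v(λ)`, `log v(λ − 1)` at every finite place `v` (`log_valuation_lam`, `log_valuation_lam_sub_one`);
* **the orders of `j(λ) = 2⁸(λ²−λ+1)³/(λ²(λ−1)²)`**: `ord_{𝔭₃} j(λ) = −2`, `ord_{𝔭₃'} j(λ) = −24`, `ord_{𝔭₄₇} j(λ) = −8`
  (`ord_jInv_𝔭₃`, `ord_jInv_𝔭₃'`, `ord_jInv_𝔭₄₇`), and `0 ≤ ord_v j(λ)` at every other finite place `v ∌ 2` (`ord_jInv_nonneg`);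
* hence **the bad places of the point away from `2` are exactly `𝔭₃, 𝔭₃', 𝔭₄₇`** (`eq_of_mem_badPlaces`), with the table's pole orders
  `h = 2, 24, 8`, at places UNRAMIFIED over `3, 47` (`ramIdx_𝔭₃`, `ramIdx_𝔭₃'`, `ramIdx_𝔭₄₇`).
Numbers re-derived in-seat (exact arithmetic in `ℤ[√7]`, HOME/abc-iut-W-row-2 gen 3): `N(λ²−λ+1)·47⁸ = 7·19·158952661561` (zeros of `j`, irrelevant
to the poles). [cite: MochizukiGenEll2010, §1 p.4, Ex 1.3 (i) p.5] [cite: Mochizuki2012, IUTchIV Cor. 2.2 (i) p.41] [cite: NeukirchANT1999, Ch. I §8]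
-/

noncomputable section

open scoped Classical NumberField

open NumberField IsDedekindDomain IsDedekindDomain.HeightOneSpectrum

namespace Summit.ABC.IUTFork.Broberg

open Sqrt7 Literature.IUT.LogVolume Literature.IUT.LogVolume.Cor22 Literature.NumberTheory.NumberFields
  Literature.NumberTheory.DiophantineGeometry.GenEll

/-! ### The point -/

/-- **Broberg's `λ = (8−3√7)²(5−2√7)/(4−3√7)⁴ ∈ ℚ(√7)`** (R-W table datum «broberg-Q7»). [cite: MochizukiGenEll2010, Ex 1.3 (i) p.5] -/
def lam : K := (8 - 3 * sqrt7) ^ 2 * (5 - 2 * sqrt7) / (4 - 3 * sqrt7) ^ 4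

/-- **The `λ`-line point `(ℚ(√7), λ)`** of Broberg's example, presented over `F_tpd = ℚ(√7)`. [cite: MochizukiGenEll2010, §1 p.4] -/
def point : NFPoint := { F := K, x := lam }

/-- The presenting field of the point is `ℚ(√7)`. [folklore] -/
theorem point_F : point.F = K := rfl

/-- The coordinate of the point is `λ`. [folklore] -/
theorem point_x : point.x = lam := rfl

/-! ### The factorisations of `λ` and `1 − λ` in `ℤ[√7]` -/

/-- `3√7 − 4 ≠ 0` in `K`. [folklore] -/
theorem den_ne_zero : (3 * sqrt7 - 4 : K) ≠ 0 := by
  rw [← coe_ϖ₄₇]; exact coe_ne_zero.2.2.1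

/-- **`λ = −(8−3√7)³(2+√7)/(3√7−4)⁴`**, i.e. `λ = −ε'³·ϖ₃/ϖ₄₇⁴` (`(8−3√7)²(5−2√7) = −(8−3√7)³(2+√7)` since `5−2√7 = −(8−3√7)(2+√7)`).
[folklore] -/
theorem lam_eq : lam = -((eps' : 𝓞 K) : K) ^ 3 * ((ϖ₃ : 𝓞 K) : K) / ((ϖ₄₇ : 𝓞 K) : K) ^ 4 := by
  rw [coe_eps', coe_ϖ₃, coe_ϖ₄₇]
  unfold lam
  have hD1 : (4 - 3 * sqrt7 : K) ^ 4 ≠ 0 := by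
    have : (4 - 3 * sqrt7 : K) = -(3 * sqrt7 - 4) := by ring
    rw [this, neg_pow]; exact mul_ne_zero (by norm_num) (pow_ne_zero 4 den_ne_zero)
  have hD2 : (3 * sqrt7 - 4 : K) ^ 4 ≠ 0 := pow_ne_zero 4 den_ne_zero
  rw [div_eq_div_iff hD1 hD2]
  linear_combination (-3 * (4 - 3 * sqrt7) ^ 4 * (8 - 3 * sqrt7) ^ 2) * sqrt7_mul_sqrt7

/-- **`1 − λ = (8+3√7)²(3+√7)³(√7−2)¹²/(3√7−4)⁴`**, i.e. `1 − λ = ε²·ϖ₂³·ϖ₃'¹²/ϖ₄₇⁴` (Broberg's identity `a + b = c` in `ℤ[√7]`).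
[folklore] -/
theorem one_sub_lam_eq :
    1 - lam = ((eps : 𝓞 K) : K) ^ 2 * ((ϖ₂ : 𝓞 K) : K) ^ 3 * ((ϖ₃' : 𝓞 K) : K) ^ 12 / ((ϖ₄₇ : 𝓞 K) : K) ^ 4 := by
  rw [lam_eq, coe_eps, coe_eps', coe_ϖ₂, coe_ϖ₃, coe_ϖ₃', coe_ϖ₄₇]
  have hD2 : (3 * sqrt7 - 4 : K) ^ 4 ≠ 0 := pow_ne_zero 4 den_ne_zero
  rw [eq_div_iff hD2, sub_mul, div_mul_cancel₀ _ hD2, one_mul]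
  linear_combination (1010944 - 4297088 * sqrt7 + 7448656 * sqrt7 ^ 2 - 6216574 * sqrt7 ^ 3 + 1586326 * sqrt7 ^ 4
    + 1483502 * sqrt7 ^ 5 - 1359814 * sqrt7 ^ 6 + 261410 * sqrt7 ^ 7 + 167798 * sqrt7 ^ 8 - 95410 * sqrt7 ^ 9
    + 5642 * sqrt7 ^ 10 + 7826 * sqrt7 ^ 11 - 1986 * sqrt7 ^ 12 - 82 * sqrt7 ^ 13 + 87 * sqrt7 ^ 14 - 9 * sqrt7 ^ 15) * sqrt7_mul_sqrt7

/-- `λ ≠ 0`. [folklore] -/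
theorem lam_ne_zero : lam ≠ 0 := by
  rw [lam_eq]
  refine div_ne_zero (mul_ne_zero (neg_ne_zero.mpr (pow_ne_zero 3 coe_ne_zero.2.2.2.2.2.2)) coe_ne_zero.1)
    (pow_ne_zero 4 coe_ne_zero.2.2.1)

/-- `1 − λ ≠ 0`. [folklore] -/
theorem one_sub_lam_ne_zero : 1 - lam ≠ 0 := by
  rw [one_sub_lam_eq]
  refine div_ne_zero (mul_ne_zero (mul_ne_zero (pow_ne_zero 2 coe_ne_zero.2.2.2.2.2.1) (pow_ne_zero 3 coe_ne_zero.2.2.2.2.1))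
    (pow_ne_zero 12 coe_ne_zero.2.1)) (pow_ne_zero 4 coe_ne_zero.2.2.1)

/-- `λ − 1 ≠ 0`. [folklore] -/
theorem lam_sub_one_ne_zero : lam - 1 ≠ 0 := fun h => one_sub_lam_ne_zero (by rw [← neg_sub, h, neg_zero])

/-! ### Valuations of `λ` and `λ − 1` at every finite place -/

/-- **`log v(λ) = −[v = 𝔭₃] + 4·[v = 𝔭₄₇]`** at every finite place `v` of `ℚ(√7)`. [folklore] -/
theorem log_valuation_lam (v : HeightOneSpectrum (𝓞 K)) :
    WithZero.log (v.valuation K lam) = -(if v = 𝔭₃ then 1 else 0) + 4 * (if v = 𝔭₄₇ then 1 else 0) := by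
  have h1 : v.valuation K (((eps' : 𝓞 K) : K) ^ 3) ≠ 0 := valuation_ne_zero_of_ne_zero v (pow_ne_zero 3 coe_ne_zero.2.2.2.2.2.2)
  have h2 : v.valuation K ((ϖ₃ : 𝓞 K) : K) ≠ 0 := valuation_ne_zero_of_ne_zero v coe_ne_zero.1
  have h3 : v.valuation K (((ϖ₄₇ : 𝓞 K) : K) ^ 4) ≠ 0 := valuation_ne_zero_of_ne_zero v (pow_ne_zero 4 coe_ne_zero.2.2.1)
  rw [lam_eq, map_div₀, map_mul, Valuation.map_neg, WithZero.log_div (mul_ne_zero h1 h2) h3, WithZero.log_mul h1 h2, map_pow,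
    map_pow, WithZero.log_pow, WithZero.log_pow, log_valuation_eps', log_valuation_ϖ₃, log_valuation_ϖ₄₇]
  split_ifs <;> simp

/-- **`log v(λ − 1) = −3·[v = 𝔭₂] − 12·[v = 𝔭₃'] + 4·[v = 𝔭₄₇]`** at every finite place `v` of `ℚ(√7)`. [folklore] -/
theorem log_valuation_lam_sub_one (v : HeightOneSpectrum (𝓞 K)) :
    WithZero.log (v.valuation K (lam - 1)) =
      -3 * (if v = 𝔭₂ then 1 else 0) - 12 * (if v = 𝔭₃' then 1 else 0) + 4 * (if v = 𝔭₄₇ then 1 else 0) := by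
  have h1 : v.valuation K (((eps : 𝓞 K) : K) ^ 2) ≠ 0 := valuation_ne_zero_of_ne_zero v (pow_ne_zero 2 coe_ne_zero.2.2.2.2.2.1)
  have h2 : v.valuation K (((ϖ₂ : 𝓞 K) : K) ^ 3) ≠ 0 := valuation_ne_zero_of_ne_zero v (pow_ne_zero 3 coe_ne_zero.2.2.2.2.1)
  have h3 : v.valuation K (((ϖ₃' : 𝓞 K) : K) ^ 12) ≠ 0 := valuation_ne_zero_of_ne_zero v (pow_ne_zero 12 coe_ne_zero.2.1)
  have h4 : v.valuation K (((ϖ₄₇ : 𝓞 K) : K) ^ 4) ≠ 0 := valuation_ne_zero_of_ne_zero v (pow_ne_zero 4 coe_ne_zero.2.2.1)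
  rw [Valuation.map_sub_swap, one_sub_lam_eq, map_div₀, map_mul, map_mul, WithZero.log_div (mul_ne_zero (mul_ne_zero h1 h2) h3) h4,
    WithZero.log_mul (mul_ne_zero h1 h2) h3, WithZero.log_mul h1 h2, map_pow, map_pow, map_pow, map_pow, WithZero.log_pow,
    WithZero.log_pow, WithZero.log_pow, WithZero.log_pow, log_valuation_eps, log_valuation_ϖ₂, log_valuation_ϖ₃', log_valuation_ϖ₄₇]
  split_ifs <;> simp

/-! ### Valuation arithmetic for `j(t) = 2⁸(t²−t+1)³/(t²(t−1)²)` (any valued field) -/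

section JInv

variable {F : Type*} [Field F] {Γ₀ : Type*} [LinearOrderedCommGroupWithZero Γ₀] (w : Valuation F Γ₀)

/-- `v(t² − t + 1) = 1` when `v(t) < 1`. [folklore] -/
theorem valuation_numerator_of_lt_one {t : F} (ht : w t < 1) : w (t ^ 2 - t + 1) = 1 := by
  have h : t ^ 2 - t + 1 = 1 + t * (t - 1) := by ring
  rw [h]
  refine Valuation.map_one_add_of_lt w ?_
  rw [map_mul, Valuation.map_sub_swap, Valuation.map_one_sub_of_lt w ht, mul_one]
  exact ht

/-- `v(t² − t + 1) = 1` when `v(t − 1) < 1`. [folklore] -/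
theorem valuation_numerator_of_sub_one_lt_one {t : F} (ht : w (t - 1) < 1) : w (t ^ 2 - t + 1) = 1 := by
  have h : t ^ 2 - t + 1 = 1 + (t - 1) * (1 + (t - 1)) := by ring
  rw [h]
  refine Valuation.map_one_add_of_lt w ?_
  rw [map_mul, Valuation.map_one_add_of_lt w ht, mul_one]
  exact ht

/-- `v(t² − t + 1) = v(t)²` and `v(t − 1) = v(t)` when `1 < v(t)` (a pole of `t`). [folklore] -/
theorem valuation_numerator_of_one_lt {t : F} (ht : 1 < w t) : w (t ^ 2 - t + 1) = w t ^ 2 ∧ w (t - 1) = w t := by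
  have hsub : w (t - 1) = w t := by
    rw [sub_eq_add_neg]
    refine Valuation.map_add_eq_of_lt_left w ?_
    rw [Valuation.map_neg, Valuation.map_one]; exact ht
  refine ⟨?_, hsub⟩
  have h : t ^ 2 - t + 1 = t ^ 2 + -(t - 1) := by ring
  rw [h]
  have ht0 : 0 < w t := lt_trans zero_lt_one ht
  have hlt : w (-(t - 1)) < w (t ^ 2) := by
    rw [Valuation.map_neg, hsub, map_pow, sq]
    exact lt_mul_of_one_lt_left ht0 ht
  rw [Valuation.map_add_eq_of_lt_left w hlt, map_pow]

/-- `v(t² − t + 1) ≤ 1` when `v(t) ≤ 1`. [folklore] -/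
theorem valuation_numerator_le_one {t : F} (ht : w t ≤ 1) : w (t ^ 2 - t + 1) ≤ 1 := by
  refine (Valuation.map_add w _ _).trans (max_le ((Valuation.map_sub w _ _).trans (max_le ?_ ht)) (by rw [Valuation.map_one]))
  rw [map_pow]
  exact pow_le_one₀ zero_le ht

/-- **`v(j(t)) = v(2)⁸·v(t²−t+1)³/(v(t)²·v(t−1)²)`.** [folklore] -/
theorem valuation_jInv (t : F) :
    w (jInv t) = w 2 ^ 8 * w (t ^ 2 - t + 1) ^ 3 / (w t ^ 2 * w (t - 1) ^ 2) := by
  unfold jInv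
  rw [map_div₀, map_mul, map_mul, map_pow, map_pow, map_pow, map_pow]

end JInv

/-! ### The orders of `j(λ)` -/

/-- `v(2) = 1` at a finite place `v ∌ 2` of `ℚ(√7)`. [folklore] -/
theorem valuation_two_eq_one {v : HeightOneSpectrum (𝓞 K)} (h2 : (2 : 𝓞 K) ∉ v.asIdeal) : v.valuation K (2 : K) = 1 := by
  have h := log_valuation_eq_zero_of_not_mem v h2
  have hne : v.valuation K (((2 : 𝓞 K) : 𝓞 K) : K) ≠ 0 := valuation_ne_zero_of_ne_zero v (by simp)
  have h2K : v.valuation K (((2 : 𝓞 K) : 𝓞 K) : K) = 1 := by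
    rw [← WithZero.exp_log hne, h, WithZero.exp_zero]
  exact_mod_cast h2K

/-- The shape of `log v(j(t))`: `log(x⁸y³/(z²w²)) = 8 log x + 3 log y − 2 log z − 2 log w`. [folklore] -/
theorem log_jInv_shape {x y z w : WithZero (Multiplicative ℤ)} (hx : x ≠ 0) (hy : y ≠ 0) (hz : z ≠ 0) (hw : w ≠ 0) :
    WithZero.log (x ^ 8 * y ^ 3 / (z ^ 2 * w ^ 2)) =
      8 * WithZero.log x + 3 * WithZero.log y - 2 * WithZero.log z - 2 * WithZero.log w := by
  rw [WithZero.log_div (mul_ne_zero (pow_ne_zero _ hx) (pow_ne_zero _ hy)) (mul_ne_zero (pow_ne_zero _ hz) (pow_ne_zero _ hw)),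
    WithZero.log_mul (pow_ne_zero _ hx) (pow_ne_zero _ hy), WithZero.log_mul (pow_ne_zero _ hz) (pow_ne_zero _ hw),
    WithZero.log_pow, WithZero.log_pow, WithZero.log_pow, WithZero.log_pow]
  simp only [nsmul_eq_mul]
  push_cast
  ring

/-- `2 ∉ 𝔭₃`, `2 ∉ 𝔭₃'`, `2 ∉ 𝔭₄₇` (they contain the odd primes `3`, `3`, `47`). [folklore] -/
theorem two_not_mem : (2 : 𝓞 K) ∉ 𝔭₃.asIdeal ∧ (2 : 𝓞 K) ∉ 𝔭₃'.asIdeal ∧ (2 : 𝓞 K) ∉ 𝔭₄₇.asIdeal := by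
  refine ⟨fun h => ?_, fun h => ?_, fun h => ?_⟩
  · have h1 : (1 : 𝓞 K) ∈ 𝔭₃.asIdeal := by
      have := Ideal.sub_mem _ three_mem_𝔭₃ h; convert this using 1; norm_num
    exact 𝔭₃.isPrime.ne_top ((Ideal.eq_top_iff_one _).mpr h1)
  · have h1 : (1 : 𝓞 K) ∈ 𝔭₃'.asIdeal := by
      have := Ideal.sub_mem _ three_mem_𝔭₃' h; convert this using 1; norm_num
    exact 𝔭₃'.isPrime.ne_top ((Ideal.eq_top_iff_one _).mpr h1)
  · have h1 : (1 : 𝓞 K) ∈ 𝔭₄₇.asIdeal := by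
      have h48 : (48 : 𝓞 K) ∈ 𝔭₄₇.asIdeal := by
        have := Ideal.mul_mem_left _ (24 : 𝓞 K) h; convert this using 1; norm_num
      have := Ideal.sub_mem _ h48 fortySeven_mem_𝔭₄₇; convert this using 1; norm_num
    exact 𝔭₄₇.isPrime.ne_top ((Ideal.eq_top_iff_one _).mpr h1)

/-- No finite place contains both `3` and `47` (`1 = 16·3 − 47`). [folklore] -/
theorem not_three_mem_of_fortySeven_mem (w : HeightOneSpectrum (𝓞 K)) (h3 : (3 : 𝓞 K) ∈ w.asIdeal)
    (h47 : (47 : 𝓞 K) ∈ w.asIdeal) : False := by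
  have h1 : (1 : 𝓞 K) ∈ w.asIdeal := by
    have h48 : (48 : 𝓞 K) ∈ w.asIdeal := by
      have := Ideal.mul_mem_left _ (16 : 𝓞 K) h3; convert this using 1; norm_num
    have := Ideal.sub_mem _ h48 h47; convert this using 1; norm_num
  exact w.isPrime.ne_top ((Ideal.eq_top_iff_one _).mpr h1)

/-- `𝔭₄₇ ∉ {𝔭₃, 𝔭₃'}` and `𝔭₂ ∉ {𝔭₃, 𝔭₃', 𝔭₄₇}`. [folklore] -/
theorem 𝔭₄₇_ne : 𝔭₄₇ ≠ 𝔭₃ ∧ 𝔭₄₇ ≠ 𝔭₃' ∧ 𝔭₂ ≠ 𝔭₃ ∧ 𝔭₂ ≠ 𝔭₃' ∧ 𝔭₂ ≠ 𝔭₄₇ := by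
  refine ⟨fun h => not_three_mem_of_fortySeven_mem 𝔭₃ three_mem_𝔭₃ (h ▸ fortySeven_mem_𝔭₄₇),
    fun h => not_three_mem_of_fortySeven_mem 𝔭₃' three_mem_𝔭₃' (h ▸ fortySeven_mem_𝔭₄₇),
    fun h => two_not_mem.1 (h ▸ two_mem_𝔭₂), fun h => two_not_mem.2.1 (h ▸ two_mem_𝔭₂), fun h => two_not_mem.2.2 (h ▸ two_mem_𝔭₂)⟩

/-- `x < 1` iff `log x < 0` and `1 < x` iff `0 < log x`, for a non-zero valuation value. [folklore] -/
theorem lt_one_of_log_neg (v : HeightOneSpectrum (𝓞 K)) {x : K} (hx : x ≠ 0) (h : WithZero.log (v.valuation K x) < 0) :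
    v.valuation K x < 1 :=
  (WithZero.log_lt_log (valuation_ne_zero_of_ne_zero v hx) one_ne_zero).mp (by rwa [WithZero.log_one])

/-- `1 < x` when `0 < log x`. [folklore] -/
theorem one_lt_of_log_pos (v : HeightOneSpectrum (𝓞 K)) {x : K} (hx : x ≠ 0) (h : 0 < WithZero.log (v.valuation K x)) :
    1 < v.valuation K x :=
  (WithZero.log_lt_log one_ne_zero (valuation_ne_zero_of_ne_zero v hx)).mp (by rwa [WithZero.log_one])

/-- **`ord_{𝔭₃} j(λ) = −2`** (`λ ≡ 0`: `v(λ) = p⁻¹`, `v(λ−1) = 1`, numerator a unit). [cite: Mochizuki2012, IUTchIV Cor. 2.2 (i) p.41] -/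
theorem ord_jInv_𝔭₃ : ord K 𝔭₃ (jInv lam) = -2 := by
  have hl : WithZero.log (𝔭₃.valuation K lam) = -1 := by
    rw [log_valuation_lam, if_pos rfl, if_neg 𝔭₄₇_ne.1.symm]; norm_num
  have hs : WithZero.log (𝔭₃.valuation K (lam - 1)) = 0 := by
    rw [log_valuation_lam_sub_one, if_neg 𝔭₄₇_ne.2.2.1.symm, if_neg 𝔭₃_ne_𝔭₃', if_neg 𝔭₄₇_ne.1.symm]; norm_num
  have hlt : 𝔭₃.valuation K lam < 1 := lt_one_of_log_neg 𝔭₃ lam_ne_zero (by rw [hl]; norm_num)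
  have hnum : 𝔭₃.valuation K (lam ^ 2 - lam + 1) = 1 := valuation_numerator_of_lt_one _ hlt
  have h2 : 𝔭₃.valuation K (2 : K) = 1 := valuation_two_eq_one two_not_mem.1
  unfold ord
  rw [valuation_jInv, log_jInv_shape (by rw [h2]; exact one_ne_zero) (by rw [hnum]; exact one_ne_zero)
    (valuation_ne_zero_of_ne_zero 𝔭₃ lam_ne_zero) (valuation_ne_zero_of_ne_zero 𝔭₃ lam_sub_one_ne_zero), h2, hnum,
    WithZero.log_one, hl, hs]
  norm_num

/-- **`ord_{𝔭₃'} j(λ) = −24`** (`λ ≡ 1`: `v(λ−1) = p⁻¹²`, `v(λ) = 1`, numerator a unit). [cite: Mochizuki2012, IUTchIV Cor. 2.2 (i) p.41] -/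
theorem ord_jInv_𝔭₃' : ord K 𝔭₃' (jInv lam) = -24 := by
  have hl : WithZero.log (𝔭₃'.valuation K lam) = 0 := by
    rw [log_valuation_lam, if_neg 𝔭₃_ne_𝔭₃'.symm, if_neg 𝔭₄₇_ne.2.1.symm]; norm_num
  have hs : WithZero.log (𝔭₃'.valuation K (lam - 1)) = -12 := by
    rw [log_valuation_lam_sub_one, if_neg 𝔭₄₇_ne.2.2.2.1.symm, if_pos rfl, if_neg 𝔭₄₇_ne.2.1.symm]; norm_num
  have hlt : 𝔭₃'.valuation K (lam - 1) < 1 := lt_one_of_log_neg 𝔭₃' lam_sub_one_ne_zero (by rw [hs]; norm_num)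
  have hnum : 𝔭₃'.valuation K (lam ^ 2 - lam + 1) = 1 := valuation_numerator_of_sub_one_lt_one _ hlt
  have h2 : 𝔭₃'.valuation K (2 : K) = 1 := valuation_two_eq_one two_not_mem.2.1
  unfold ord
  rw [valuation_jInv, log_jInv_shape (by rw [h2]; exact one_ne_zero) (by rw [hnum]; exact one_ne_zero)
    (valuation_ne_zero_of_ne_zero 𝔭₃' lam_ne_zero) (valuation_ne_zero_of_ne_zero 𝔭₃' lam_sub_one_ne_zero), h2, hnum,
    WithZero.log_one, hl, hs]
  norm_num

/-- **`ord_{𝔭₄₇} j(λ) = −8`** (`λ` has a pole of order `4`: `v(λ) = v(λ−1) = p⁴`, `v(λ²−λ+1) = p⁸`). [cite: Mochizuki2012, IUTchIV Cor. 2.2 (i) p.41] -/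
theorem ord_jInv_𝔭₄₇ : ord K 𝔭₄₇ (jInv lam) = -8 := by
  have hl : WithZero.log (𝔭₄₇.valuation K lam) = 4 := by
    rw [log_valuation_lam, if_neg 𝔭₄₇_ne.1, if_pos rfl]; norm_num
  have hgt : 1 < 𝔭₄₇.valuation K lam := one_lt_of_log_pos 𝔭₄₇ lam_ne_zero (by rw [hl]; norm_num)
  obtain ⟨hnum, hsub⟩ := valuation_numerator_of_one_lt (𝔭₄₇.valuation K) hgt
  have h2 : 𝔭₄₇.valuation K (2 : K) = 1 := valuation_two_eq_one two_not_mem.2.2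
  have hlam0 : 𝔭₄₇.valuation K lam ≠ 0 := valuation_ne_zero_of_ne_zero 𝔭₄₇ lam_ne_zero
  unfold ord
  rw [valuation_jInv, log_jInv_shape (by rw [h2]; exact one_ne_zero) (by rw [hnum]; exact pow_ne_zero _ hlam0) hlam0
    (valuation_ne_zero_of_ne_zero 𝔭₄₇ lam_sub_one_ne_zero), h2, hnum, hsub, WithZero.log_one, WithZero.log_pow, hl]
  norm_num

/-- **`0 ≤ ord_v j(λ)` at every finite place `v ∌ 2` other than `𝔭₃, 𝔭₃', 𝔭₄₇`** (`λ` and `λ − 1` are `v`-units, the numerator is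
`v`-integral). [cite: Mochizuki2012, IUTchIV Cor. 2.2 (i) p.41] -/
theorem ord_jInv_nonneg {v : HeightOneSpectrum (𝓞 K)} (h2 : (2 : 𝓞 K) ∉ v.asIdeal) (h3 : v ≠ 𝔭₃) (h3' : v ≠ 𝔭₃') (h47 : v ≠ 𝔭₄₇) :
    0 ≤ ord K v (jInv lam) := by
  have hv2 : v ≠ 𝔭₂ := fun h => h2 (h ▸ two_mem_𝔭₂)
  have hexp : ∀ {x : K}, x ≠ 0 → WithZero.log (v.valuation K x) = 0 → v.valuation K x = 1 := fun hx h => by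
    rw [← WithZero.exp_log (valuation_ne_zero_of_ne_zero v hx), h, WithZero.exp_zero]
  have hlam : v.valuation K lam = 1 :=
    hexp lam_ne_zero (by rw [log_valuation_lam, if_neg h3, if_neg h47]; norm_num)
  have hsub : v.valuation K (lam - 1) = 1 :=
    hexp lam_sub_one_ne_zero (by rw [log_valuation_lam_sub_one, if_neg hv2, if_neg h3', if_neg h47]; norm_num)
  have hnum : v.valuation K (lam ^ 2 - lam + 1) ≤ 1 := valuation_numerator_le_one _ hlam.le
  have hj : v.valuation K (jInv lam) ≤ 1 := by
    rw [valuation_jInv, valuation_two_eq_one h2, hlam, hsub]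
    simp only [one_pow, one_mul, mul_one, div_one]
    exact pow_le_one₀ zero_le hnum
  unfold ord
  by_cases h0 : v.valuation K (jInv lam) = 0
  · rw [h0, WithZero.log_zero, neg_zero]
  · have h1 : WithZero.log (v.valuation K (jInv lam)) ≤ 0 :=
      (WithZero.log_le_iff_le_exp h0).mpr (by rwa [WithZero.exp_zero])
    omega

/-- **The bad places of Broberg's point away from `2` are `𝔭₃, 𝔭₃', 𝔭₄₇`.** [cite: Mochizuki2012, IUTchIV Cor. 2.2 (i) p.41] -/
theorem eq_of_mem_badPlaces (v : HeightOneSpectrum (𝓞 K)) (hv : v ∈ badPlaces point) (h2 : (2 : 𝓞 K) ∉ v.asIdeal) :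
    v = 𝔭₃ ∨ v = 𝔭₃' ∨ v = 𝔭₄₇ := by
  have hv' : ord K v (jInv lam) < 0 := (mem_badPlaces_iff_ord_neg point v).mp hv
  by_contra h
  push Not at h
  exact absurd hv' (not_lt.mpr (ord_jInv_nonneg h2 h.1 h.2.1 h.2.2))

/-- `𝔭₃, 𝔭₃', 𝔭₄₇` ARE bad places of the point (`ord < 0`). [cite: Mochizuki2012, IUTchIV Cor. 2.2 (i) p.41] -/
theorem mem_badPlaces : 𝔭₃ ∈ badPlaces point ∧ 𝔭₃' ∈ badPlaces point ∧ 𝔭₄₇ ∈ badPlaces point := by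
  refine ⟨(mem_badPlaces_iff_ord_neg point 𝔭₃).mpr ?_, (mem_badPlaces_iff_ord_neg point 𝔭₃').mpr ?_,
    (mem_badPlaces_iff_ord_neg point 𝔭₄₇).mpr ?_⟩
  · show ord K 𝔭₃ (jInv lam) < 0
    rw [ord_jInv_𝔭₃]; norm_num
  · show ord K 𝔭₃' (jInv lam) < 0
    rw [ord_jInv_𝔭₃']; norm_num
  · show ord K 𝔭₄₇ (jInv lam) < 0
    rw [ord_jInv_𝔭₄₇]; norm_num

/-- `𝔭₄₇'` is NOT a bad place of the point (`λ`, `λ − 1` are units there). [cite: Mochizuki2012, IUTchIV Cor. 2.2 (i) p.41] -/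
theorem 𝔭₄₇'_not_mem_badPlaces : 𝔭₄₇' ∉ badPlaces point := by
  intro h
  have h2 : (2 : 𝓞 K) ∉ 𝔭₄₇'.asIdeal := fun h2 => by
    have h1 : (1 : 𝓞 K) ∈ 𝔭₄₇'.asIdeal := by
      have h48 : (48 : 𝓞 K) ∈ 𝔭₄₇'.asIdeal := by
        have := Ideal.mul_mem_left _ (24 : 𝓞 K) h2; convert this using 1; norm_num
      have := Ideal.sub_mem _ h48 fortySeven_mem_𝔭₄₇'; convert this using 1; norm_num
    exact 𝔭₄₇'.isPrime.ne_top ((Ideal.eq_top_iff_one _).mpr h1)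
  rcases eq_of_mem_badPlaces 𝔭₄₇' h h2 with h | h | h
  · exact not_three_mem_of_fortySeven_mem 𝔭₃ three_mem_𝔭₃ (h ▸ fortySeven_mem_𝔭₄₇')
  · exact not_three_mem_of_fortySeven_mem 𝔭₃' three_mem_𝔭₃' (h ▸ fortySeven_mem_𝔭₄₇')
  · exact 𝔭₄₇_ne_𝔭₄₇' h.symm

/-! ### `3`, `47` are unramified at the bad places -/

/-- **`e(𝔭₃ | 3) = e(𝔭₃' | 3) = 1`** (`ord_v(3) = 1`). [cite: NeukirchANT1999, Ch. I §8] -/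
theorem ramIdx_𝔭₃ : ramIdx K 𝔭₃ = 1 ∧ ramIdx K 𝔭₃' = 1 := by
  haveI : Fact (Nat.Prime 3) := ⟨Nat.prime_three⟩
  have h1 : (ord K 𝔭₃ ((3 : ℕ) : K)) = ramIdx K 𝔭₃ :=
    ord_natCast_eq_ramIdx 3 𝔭₃ (mem_placesOver_of_natCast_mem 3 𝔭₃ (by exact_mod_cast three_mem_𝔭₃))
  have h2 : (ord K 𝔭₃' ((3 : ℕ) : K)) = ramIdx K 𝔭₃' :=
    ord_natCast_eq_ramIdx 3 𝔭₃' (mem_placesOver_of_natCast_mem 3 𝔭₃' (by exact_mod_cast three_mem_𝔭₃'))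
  unfold ord at h1 h2
  rw [Nat.cast_ofNat, log_valuation_three (Or.inl rfl)] at h1
  rw [Nat.cast_ofNat, log_valuation_three (Or.inr rfl)] at h2
  constructor <;> omega

/-- **`e(𝔭₄₇ | 47) = 1`** (`ord_v(47) = 1`). [cite: NeukirchANT1999, Ch. I §8] -/
theorem ramIdx_𝔭₄₇ : ramIdx K 𝔭₄₇ = 1 := by
  haveI : Fact (Nat.Prime 47) := ⟨by norm_num⟩
  have h1 : (ord K 𝔭₄₇ ((47 : ℕ) : K)) = ramIdx K 𝔭₄₇ :=
    ord_natCast_eq_ramIdx 47 𝔭₄₇ (mem_placesOver_of_natCast_mem 47 𝔭₄₇ (by exact_mod_cast fortySeven_mem_𝔭₄₇))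
  unfold ord at h1
  rw [Nat.cast_ofNat, log_valuation_fortySeven] at h1
  omega

end Summit.ABC.IUTFork.Broberg

end
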